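import Literature.NumberTheory.Transcendental.KZCalculus
import HarnessLib

/-!
# Unfolded Stokes relators in the Kontsevich–Zagier calculus

Definition request `defn-KZ.unfoldedStokesRel` of route KontsevichZagierPeriods/UnfoldedStokes
(`Summits/KontsevichZagierPeriods/KontsevichZagierPeriods/Theses/UnfoldedStokes.lean`, thesis
part A; idea card `unfolding-abelian-integrals-riemann-bilinear`). Over the calculus of moves of
`KZCalculus.lean` (`KZ.IntegralRep`, `KZ.FormalRep`, `KZ.of`, `KZ.eval`, the four move sets and
`KZ.relations`), Kontsevich–Zagier's rule 3) in several variables reads "replace the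
Newton–Leibniz formula by Stokes's formula" [KZ 2001, §1.2; cf. §4.1, Definition, relation (3)].
The route singles out the instances of Stokes' formula `∫_{∂D} f η = ∫_D ω ∧ η + ∫_D f dη` on the
unit cube `D = (0,1)ⁿ⁺¹` in which the function `f` is the ABELIAN INTEGRAL of a closed
`ℚ`-semialgebraic `1`-form `ω = Σᵢ aᵢ dpᵢ` along the rays from `0` — never written down, but
*unfolded* into one more variable `u ∈ (0,1)` through the homotopy operator of the Poincaré lemma
[Bott–Tu 1982, §4]: `f(p) = ∫₀¹ Ω(p,u) du` with the `ℚ`-semialgebraic integrand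
`Ω(p,u) = ⟨ω(u p), p⟩ = Σᵢ pᵢ aᵢ(u p)` (`KZ.unfolding`). Every integral in Stokes' formula is then
an absolutely convergent integral of a semialgebraic function over a cube:

* faces: `∫_{F × (0,1)} Ω(ι(y), u) · gⱼ(ι(y))`, `ι = Fin.insertNth j c` the face `{pⱼ = c}`,
  `c ∈ {0, 1}`, of the cube, `η = Σⱼ gⱼ dp₀ ∧ ⋯ \widehat{dpⱼ} ⋯ ∧ dpₙ`
  (`UnfoldedStokesData.faceIntegrand`);
* `∫_D ω ∧ η = ∫_D Σⱼ (−1)ʲ aⱼ gⱼ` (`UnfoldedStokesData.wedgeIntegrand`);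
* `∫_D f dη = ∫_{D × (0,1)} Ω(p,u) · Σⱼ (−1)ʲ ∂ⱼgⱼ(p)` (`UnfoldedStokesData.divIntegrand`).

`KZ.unfoldedStokesRel : Set KZ.FormalRep` is the set of the resulting formal combinations
`Σⱼ (−1)ʲ ([Fⱼ¹ × (0,1), Ω gⱼ] − [Fⱼ⁰ × (0,1), Ω gⱼ]) − [D, ω ∧ η] − [D × (0,1), Ω dη]`
(signs = induced boundary orientation of the faces `pⱼ = 1`, `pⱼ = 0`), over all dimensions and
all data `UnfoldedStokesData n`: an open `U ⊇ [0,1]ⁿ⁺¹` star-shaped about `0`, coefficients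
`aᵢ`, `gⱼ` that are `C¹` and `ℚ`-semialgebraic on `U` together with the first partials that occur,
and `ω` closed on `U`. In dimension `2` (`n = 1`, `ω = a ds + b dt`, `η = e dt + c ds`, i.e.
`g = ![e, c]`) these are exactly the data and the six representations of the route's crux
`UnfoldedStokesSquare` (`KZ.square_mem_unfoldedStokesRel`).

## Main definitions

* `KZ.unitCube m` — the open unit cube `{x | ∀ i, x i ∈ (0,1)} ⊆ ℝᵐ` (the cell of every crux of
  the route, written in the same form).
* `KZ.unfolding a p u = Σᵢ pᵢ aᵢ(u • p)` — the homotopy-operator integrand `Ω`.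
* `KZ.UnfoldedStokesData n` — the smooth semialgebraic data `(U, a, g)` of one instance on the
  unit `(n+1)`-cube, with `faceIntegrand`, `wedgeIntegrand`, `divIntegrand`; `KZ.stokesRelator` — the signed formal
  combination of face, wedge and divergence representations.
* `KZ.unfoldedStokesRel` — the unfolded Stokes relators; `KZ.stokesRelations` — the subgroup
  generated by the four moves together with them (the target of thesis part B, "Stokes
  generation": `KZ.eval.ker ≤ KZ.stokesRelations`).

## Main statements (all proved)

* `KZ.mem_unfoldedStokesRel_iff` (`Iff.rfl`), `KZ.UnfoldedStokesData.stokesRelator_mem`,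
  `KZ.stokesRelator_one` (the square: the six-term combination of the crux);
* `KZ.relations_le_stokesRelations`, `KZ.unfoldedStokesRel_subset_stokesRelations`,
  `KZ.stokesRelations_eq_relations_of_subset` (thesis part A `unfoldedStokesRel ⊆ relations`
  collapses `stokesRelations` to `relations`, so A ∧ B give the kernel conjecture
  `KZ.eval.ker ≤ KZ.relations`: `KZ.ker_eval_le_relations_of_subset_of_le`);
* `KZ.square_mem_unfoldedStokesRel` — the hypotheses of crux `UnfoldedStokesSquare`, verbatim,
  give `[rB] + [rR] − [rT] − [rL] − [rW] − [rD] ∈ unfoldedStokesRel`.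

Soundness (`eval c = 0` for `c ∈ unfoldedStokesRel`: Stokes' theorem on the cube, by Fubini and
the fundamental theorem of calculus in each `pⱼ` and in `u`, the closedness of `ω` turning
`∂ⱼΩ` into `∂ᵤ(u · aⱼ(u p))`) is value-level integration theory and is NOT part of this file; it
is the subject of the companion file `KZUnfoldedStokesProofs.lean`.

## References

* M. Kontsevich, D. Zagier, *Periods*, in: Mathematics Unlimited — 2001 and Beyond, Springer
  (2001), 771–808 [KontsevichZagierPeriods2001]: §1.2 rules 1)–3) ("replaces the Newton–Leibniz
  formula by Stokes's formula in rule 3)", held copy `paper:url-4812d7ce6862` p. 8) and §4.1,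
  Definition, relation (3) (Stokes formula in the algebra of effective periods, p. 32).
* R. Bott, L. W. Tu, *Differential Forms in Algebraic Topology*, GTM 82, Springer (1982)
  [BottTu1982Forms]: §4, the homotopy operator `K` of the Poincaré lemma.
* P. Griffiths, J. Harris, *Principles of Algebraic Geometry*, Wiley (1978)
  [GriffithsHarrisPrinciples1978]: Ch. 2 §2 (Stokes on the cut polygon with `f = ∫ ω`, the
  reciprocity / Riemann bilinear relations the route derives from these relators).

## Design notes

* ROUTE-POSITED NOTION. `unfoldedStokesRel` is the relator set proposed by the route; what is in
  print is Stokes' formula as KZ's rule 3) and the homotopy formula. The docstrings say so.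
* Shape modelled on `KZ.newtonLeibnizRel`: a `Set FormalRep` cut out by an `∃` over the data, the
  representations being constrained only through equations on their domains and `EqOn`
  conditions on their integrands (so any representations with these domains/integrands qualify,
  exactly as in the route's cruxes). The smooth data are bundled in the structure
  `UnfoldedStokesData` (CONVENTIONS §9: a hypothesis structure rather than a tower of hypotheses).
* `(n−1)`-forms are written in the UNSIGNED basis `dp₀ ∧ ⋯ \widehat{dpⱼ} ⋯ ∧ dpₙ`, so that for
  `n + 1 = 2` the coefficients are literally the crux's `(e, c)` (`η = c ds + e dt = e ⋆₀ + c ⋆₁`);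
  the orientation signs `(−1)ʲ` then sit in `ω ∧ η = Σ (−1)ʲ aⱼ gⱼ vol`,
  `dη = Σ (−1)ʲ ∂ⱼ gⱼ vol` and in front of the face terms.
* Base point `0` and the unit cube only: other cells and base points are reached by additivity
  and `ℚ`-semialgebraic changes of variables (the other moves), as the route prescribes.
* The cell dimension is `n + 1` (`n : ℕ`), so that faces are indexed by `Fin (n + 1)` and face
  representations live in `IntegralRep (n + 1)` (`n` face coordinates, then `u` last) without
  natural-number subtraction; `IntegralRep (1 + 1)` and `IntegralRep 2` agree definitionally.
-/

noncomputable section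

open MeasureTheory Set

namespace Literature.NumberTheory.Transcendental

namespace KZ

variable {m n : ℕ}

/-! ### The cell and the unfolding integrand -/

/-- The open unit cube `(0,1)ᵐ ⊆ ℝᵐ`, written as `{x | ∀ i, x i ∈ Set.Ioo 0 1}` (the form used by
the cruxes of route KontsevichZagierPeriods/UnfoldedStokes). [folklore] -/
def unitCube (m : ℕ) : Set (Fin m → ℝ) := {x | ∀ i, x i ∈ Ioo (0 : ℝ) 1}

/-- Membership in the open unit cube. [folklore] -/
@[simp] theorem mem_unitCube {x : Fin m → ℝ} : x ∈ unitCube m ↔ ∀ i, x i ∈ Ioo (0 : ℝ) 1 :=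
  Iff.rfl

/-- The open unit cube is the product of the open unit intervals. [folklore] -/
theorem unitCube_eq_pi (m : ℕ) : unitCube m = Set.pi univ fun _ => Ioo (0 : ℝ) 1 := by
  ext x; simp [unitCube]

/-- The open unit cube is open. [folklore] -/
theorem isOpen_unitCube (m : ℕ) : IsOpen (unitCube m) := by
  rw [unitCube_eq_pi]; exact isOpen_set_pi finite_univ fun _ _ => isOpen_Ioo

/-- The open unit cube lies in the closed unit cube `Set.Icc 0 1`. [folklore] -/
theorem unitCube_subset_Icc (m : ℕ) : unitCube m ⊆ Icc (0 : Fin m → ℝ) 1 := fun _ hx =>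
  ⟨fun i => (hx i).1.le, fun i => (hx i).2.le⟩

/-- **The unfolding (homotopy-operator) integrand** of a `1`-form `ω = Σᵢ aᵢ dpᵢ` on `ℝᵐ` with
respect to the base point `0`: `Ω(p, u) = ⟨ω(u p), p⟩ = Σᵢ pᵢ · aᵢ(u • p)`, so that
`f(p) = ∫₀¹ Ω(p, u) du` is the integral of `ω` along the segment from `0` to `p` — the homotopy
(cone) operator of the Poincaré lemma applied to `ω`: for closed `ω` on an open set star-shaped
about `0`, `df = ω` (classical; cf. Bott–Tu 1982, §4, integration along the fibre and the
homotopy operator `K`). [folklore] -/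
def unfolding (a : Fin m → (Fin m → ℝ) → ℝ) (p : Fin m → ℝ) (u : ℝ) : ℝ :=
  ∑ i, p i * a i (u • p)

/-- `unfolding` unfolded. [folklore] -/
theorem unfolding_apply (a : Fin m → (Fin m → ℝ) → ℝ) (p : Fin m → ℝ) (u : ℝ) :
    unfolding a p u = ∑ i, p i * a i (u • p) := rfl

/-- The formal combination of an unfolded Stokes instance on the unit `(n+1)`-cube built on
representations `r₀ j` (faces `pⱼ = 0`), `r₁ j` (faces `pⱼ = 1`), `rW` (`ω ∧ η`) and `rD` (`f dη`,
unfolded): `Σⱼ (−1)ʲ ([r₁ j] − [r₀ j]) − [rW] − [rD]`, the signs being the induced boundary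
orientations of the faces of the cube. On representations carrying an unfolded Stokes datum it
evaluates to `∫_{∂D} f η − ∫_D ω ∧ η − ∫_D f dη`. [cite: KontsevichZagierPeriods2001, §1.2 rule 3] -/
def stokesRelator (r₀ r₁ : Fin (n + 1) → IntegralRep (n + 1)) (rW : IntegralRep (n + 1))
    (rD : IntegralRep (n + 2)) : FormalRep :=
  ∑ j : Fin (n + 1), ((-1 : ℤ) ^ (j : ℕ)) • (of (r₁ j) - of (r₀ j)) - of rW - of rD

/-- The unfolded Stokes relator of the square (`n + 1 = 2`) is the six-term combination
`[r₀ 1] + [r₁ 0] − [r₁ 1] − [r₀ 0] − [rW] − [rD]` (bottom + right − top − left − wedge − div) of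
crux `UnfoldedStokesSquare`. [cite: KontsevichZagierPeriods2001, §1.2 rule 3] -/
theorem stokesRelator_one (r₀ r₁ : Fin 2 → IntegralRep 2) (rW : IntegralRep 2)
    (rD : IntegralRep 3) : stokesRelator r₀ r₁ rW rD =
      of (r₀ 1) + of (r₁ 0) - of (r₁ 1) - of (r₀ 0) - of rW - of rD := by
  show (∑ j : Fin 2, ((-1 : ℤ) ^ (j : ℕ)) • (of (r₁ j) - of (r₀ j))) - of rW - of rD = _
  rw [Fin.sum_univ_two, Fin.val_zero, Fin.val_one, pow_zero, pow_one, one_zsmul, neg_one_zsmul]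
  abel

/-! ### The data of an unfolded Stokes instance -/

/-- **Data of an unfolded Stokes instance on the unit `(n+1)`-cube** (route
KontsevichZagierPeriods/UnfoldedStokes, thesis part A): an open set `U ⊇ [0,1]ⁿ⁺¹` star-shaped
about `0`; the coefficients `a i` of a `1`-form `ω = Σᵢ aᵢ dpᵢ` and `g j` of an `n`-form
`η = Σⱼ gⱼ dp₀ ∧ ⋯ ∧ \widehat{dpⱼ} ∧ ⋯ ∧ dpₙ` (unsigned basis), all `C¹` and `ℚ`-semialgebraic on
`U`; `ω` closed on `U` (`∂ⱼ aᵢ = ∂ᵢ aⱼ`); and — as in the route's crux, so that every intermediate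
integrand of the derivation is visibly semialgebraic — the first partials `∂ⱼ aᵢ` and `∂ⱼ gⱼ` also
`ℚ`-semialgebraic on `U`. For `n + 1 = 2` this is verbatim the data `(U, a, b, c, e)` of crux
`UnfoldedStokesSquare` with `a = ![a, b]`, `g = ![e, c]`. The notion is posited by the route;
in print are Stokes' formula as rule 3) [Kontsevich–Zagier 2001, §1.2] and the homotopy operator
[Bott–Tu 1982, §4]. [cite: KontsevichZagierPeriods2001, §1.2 rule 3] -/
structure UnfoldedStokesData (n : ℕ) where
  /-- The open neighbourhood of the closed cube carrying the forms. -/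
  U : Set (Fin (n + 1) → ℝ)
  /-- The coefficients of the `1`-form `ω = Σᵢ a i dpᵢ`. -/
  a : Fin (n + 1) → (Fin (n + 1) → ℝ) → ℝ
  /-- The coefficients of the `n`-form `η = Σⱼ g j dp₀ ∧ ⋯ ∧ \widehat{dpⱼ} ∧ ⋯ ∧ dpₙ`. -/
  g : Fin (n + 1) → (Fin (n + 1) → ℝ) → ℝ
  isOpen : IsOpen U
  Icc_subset : Icc (0 : Fin (n + 1) → ℝ) 1 ⊆ U
  /-- `U` is star-shaped about `0`. -/
  smul_mem : ∀ p ∈ U, ∀ u ∈ Icc (0 : ℝ) 1, u • p ∈ U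
  contDiffOn_a : ∀ i, ContDiffOn ℝ 1 (a i) U
  contDiffOn_g : ∀ j, ContDiffOn ℝ 1 (g j) U
  /-- `ω` is closed on `U`: `∂ⱼ aᵢ = ∂ᵢ aⱼ`. -/
  closed : ∀ i j, ∀ p ∈ U, fderiv ℝ (a i) p (Pi.single j 1) = fderiv ℝ (a j) p (Pi.single i 1)
  isSemialgebraicFunOn_a : ∀ i, IsSemialgebraicFunOn ℚ U (a i)
  isSemialgebraicFunOn_g : ∀ j, IsSemialgebraicFunOn ℚ U (g j)
  isSemialgebraicFunOn_fderiv_a :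
    ∀ i j, IsSemialgebraicFunOn ℚ U fun p => fderiv ℝ (a i) p (Pi.single j 1)
  isSemialgebraicFunOn_fderiv_g :
    ∀ j, IsSemialgebraicFunOn ℚ U fun p => fderiv ℝ (g j) p (Pi.single j 1)

namespace UnfoldedStokesData

variable (D : UnfoldedStokesData n)

/-- The integrand of the face representation over `{pⱼ = c} × (0,1)` (coordinates: the `n` face
coordinates `Fin.init y`, then `u = y (Fin.last n)`): `Ω(ι y, u) · gⱼ(ι y)` with
`ι y = Fin.insertNth j c (Fin.init y)` the point of the face. Its `u`-integral is `f · η|_{face}`.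
[cite: KontsevichZagierPeriods2001, §1.2 rule 3] -/
def faceIntegrand (j : Fin (n + 1)) (c : ℝ) (y : Fin (n + 1) → ℝ) : ℝ :=
  unfolding D.a (Fin.insertNth j c (Fin.init y)) (y (Fin.last n)) *
    D.g j (Fin.insertNth j c (Fin.init y))

/-- The integrand of `∫_D ω ∧ η`: `ω ∧ η = (Σⱼ (−1)ʲ aⱼ gⱼ) dp₀ ∧ ⋯ ∧ dpₙ`.
[cite: KontsevichZagierPeriods2001, §1.2 rule 3] -/
def wedgeIntegrand (p : Fin (n + 1) → ℝ) : ℝ :=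
  ∑ j : Fin (n + 1), (-1 : ℝ) ^ (j : ℕ) * (D.a j p * D.g j p)

/-- The integrand of the unfolded `∫_D f dη` over `D × (0,1)` (coordinates `p = Fin.init z`,
`u = z (Fin.last (n+1))`): `Ω(p, u) · Σⱼ (−1)ʲ ∂ⱼ gⱼ(p)`, since `dη = (Σⱼ (−1)ʲ ∂ⱼ gⱼ) dp₀ ∧ ⋯ ∧ dpₙ`.
[cite: KontsevichZagierPeriods2001, §1.2 rule 3] -/
def divIntegrand (z : Fin (n + 2) → ℝ) : ℝ :=
  unfolding D.a (Fin.init z) (z (Fin.last (n + 1))) *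
    ∑ j : Fin (n + 1), (-1 : ℝ) ^ (j : ℕ) * fderiv ℝ (D.g j) (Fin.init z) (Pi.single j 1)

/-- Representations `r₀ j`, `r₁ j`, `rW`, `rD` *carry* the instance `D` if their domains are the
unit cubes and their integrands agree there with the face, wedge and divergence integrands of `D`
(only these equations are imposed, as in the move sets of `KZCalculus.lean`).
[cite: KontsevichZagierPeriods2001, §1.2 rule 3] -/
def IsCarriedBy (r₀ r₁ : Fin (n + 1) → IntegralRep (n + 1)) (rW : IntegralRep (n + 1))
    (rD : IntegralRep (n + 2)) : Prop :=
  (∀ j, (r₀ j).domain = unitCube (n + 1)) ∧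
  (∀ j, EqOn (r₀ j).integrand (D.faceIntegrand j 0) (unitCube (n + 1))) ∧
  (∀ j, (r₁ j).domain = unitCube (n + 1)) ∧
  (∀ j, EqOn (r₁ j).integrand (D.faceIntegrand j 1) (unitCube (n + 1))) ∧
  rW.domain = unitCube (n + 1) ∧ EqOn rW.integrand D.wedgeIntegrand (unitCube (n + 1)) ∧
  rD.domain = unitCube (n + 2) ∧ EqOn rD.integrand D.divIntegrand (unitCube (n + 2))

end UnfoldedStokesData

/-! ### The relator set -/

/-- **Unfolded Stokes relators** (route KontsevichZagierPeriods/UnfoldedStokes, thesis part A):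
the formal combinations `Σⱼ (−1)ʲ ([Fⱼ¹ × (0,1), Ω gⱼ] − [Fⱼ⁰ × (0,1), Ω gⱼ]) − [D, ω ∧ η] −
[D × (0,1), Ω · dη]` over all dimensions `n + 1`, all data `D : UnfoldedStokesData n` and all
representations carrying `D` (`UnfoldedStokesData.IsCarriedBy`). Each is Stokes' formula
`∫_{∂D} f η = ∫_D ω ∧ η + ∫_D f dη` on the unit cube for `f = ∫₀¹ Ω(·, u) du` the abelian integral
of the closed form `ω` (Kontsevich–Zagier's rule 3) in several variables, "replace the
Newton–Leibniz formula by Stokes's formula"), with `f` unfolded into the extra variable `u` so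
that all integrands stay `ℚ`-semialgebraic. The route's thesis: part A, `unfoldedStokesRel ⊆
relations` (each relator is a finite chain of moves (1)–(3)); part B, `eval.ker ≤ stokesRelations`.
[Kontsevich–Zagier 2001, §1.2 rule 3) and §4.1 relation (3); Bott–Tu 1982, §4]
[cite: KontsevichZagierPeriods2001, §1.2 rule 3] -/
def unfoldedStokesRel : Set FormalRep :=
  {c | ∃ (n : ℕ) (D : UnfoldedStokesData n) (r₀ r₁ : Fin (n + 1) → IntegralRep (n + 1))
      (rW : IntegralRep (n + 1)) (rD : IntegralRep (n + 2)),
    D.IsCarriedBy r₀ r₁ rW rD ∧ c = stokesRelator r₀ r₁ rW rD}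

/-- Membership in `unfoldedStokesRel`, unfolded. [cite: KontsevichZagierPeriods2001, §1.2 rule 3] -/
theorem mem_unfoldedStokesRel_iff {c : FormalRep} :
    c ∈ unfoldedStokesRel ↔ ∃ (n : ℕ) (D : UnfoldedStokesData n)
      (r₀ r₁ : Fin (n + 1) → IntegralRep (n + 1)) (rW : IntegralRep (n + 1))
      (rD : IntegralRep (n + 2)), D.IsCarriedBy r₀ r₁ rW rD ∧ c = stokesRelator r₀ r₁ rW rD :=
  Iff.rfl

/-- The relator of representations carrying an unfolded Stokes datum is an unfolded Stokes
relator. [cite: KontsevichZagierPeriods2001, §1.2 rule 3] -/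
theorem UnfoldedStokesData.stokesRelator_mem (D : UnfoldedStokesData n)
    {r₀ r₁ : Fin (n + 1) → IntegralRep (n + 1)} {rW : IntegralRep (n + 1)}
    {rD : IntegralRep (n + 2)} (h : D.IsCarriedBy r₀ r₁ rW rD) :
    stokesRelator r₀ r₁ rW rD ∈ unfoldedStokesRel :=
  ⟨n, D, r₀, r₁, rW, rD, h, rfl⟩

/-- **Stokes relations**: the subgroup of `FormalRep` generated by the four moves of the KZ
calculus together with the unfolded Stokes relators — the right-hand side of thesis part B
("Stokes generation": `eval.ker ≤ stokesRelations`) of route KontsevichZagierPeriods/UnfoldedStokes.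
[cite: KontsevichZagierPeriods2001, §1.2 rule 3] -/
def stokesRelations : AddSubgroup FormalRep :=
  AddSubgroup.closure
    (domainAddRel ∪ integrandAddRel ∪ changeOfVariablesRel ∪ newtonLeibnizRel ∪ unfoldedStokesRel)

/-- `stokesRelations` unfolded. [cite: KontsevichZagierPeriods2001, §1.2 rule 3] -/
theorem stokesRelations_def : stokesRelations = AddSubgroup.closure
    (domainAddRel ∪ integrandAddRel ∪ changeOfVariablesRel ∪ newtonLeibnizRel ∪
      unfoldedStokesRel) := rfl

/-- The KZ relations are Stokes relations. [cite: KontsevichZagierPeriods2001, §1.2] -/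
theorem relations_le_stokesRelations : relations ≤ stokesRelations :=
  AddSubgroup.closure_mono subset_union_left

/-- Unfolded Stokes relators are Stokes relations. [cite: KontsevichZagierPeriods2001, §1.2 rule 3] -/
theorem unfoldedStokesRel_subset_stokesRelations : unfoldedStokesRel ⊆ stokesRelations :=
  fun _ hc => AddSubgroup.subset_closure (Or.inr hc)

/-- If every unfolded Stokes relator is already a KZ relation (thesis part A of the route), the
Stokes relations are exactly the KZ relations. [cite: KontsevichZagierPeriods2001, §1.2 rule 3] -/
theorem stokesRelations_eq_relations_of_subset (h : unfoldedStokesRel ⊆ relations) :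
    stokesRelations = relations := by
  refine le_antisymm ?_ relations_le_stokesRelations
  refine (AddSubgroup.closure_le _).mpr ?_
  rintro c (hc | hc)
  · exact AddSubgroup.subset_closure hc
  · exact h hc

/-- **A ∧ B ⇒ kernel form.** If the unfolded Stokes relators are KZ relations (part A) and the
kernel of evaluation is generated by moves and unfolded Stokes relators (part B, Stokes
generation), then `ker eval ≤ relations` — the inclusion that, with soundness
`relations ≤ ker eval` (`KZ.relations_le_ker_eval`), is the kernel form of Kontsevich–Zagier's
Conjecture 1. [cite: KontsevichZagierPeriods2001, §1.2 Conjecture 1] -/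
theorem ker_eval_le_relations_of_subset_of_le (hA : unfoldedStokesRel ⊆ relations)
    (hB : eval.ker ≤ stokesRelations) : eval.ker ≤ relations :=
  hB.trans (stokesRelations_eq_relations_of_subset hA).le

/-! ### The square: the data of crux `UnfoldedStokesSquare` -/

section Square

variable {U : Set (Fin 2 → ℝ)} {a b c e : (Fin 2 → ℝ) → ℝ}

/-- The data `(U, a, b, c, e)` of crux `UnfoldedStokesSquare` (unit square, base point `0`,
`ω = a ds + b dt` closed, `η = c ds + e dt`), with exactly its hypotheses, packaged as an
`UnfoldedStokesData 1` with `a = ![a, b]`, `g = ![e, c]`.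
[cite: KontsevichZagierPeriods2001, §1.2 rule 3] -/
def UnfoldedStokesData.square (hU : IsOpen U) (hUI : Icc (0 : Fin 2 → ℝ) 1 ⊆ U)
    (hstar : ∀ p ∈ U, ∀ u ∈ Icc (0 : ℝ) 1, u • p ∈ U)
    (ha : ContDiffOn ℝ 1 a U) (hb : ContDiffOn ℝ 1 b U) (hc : ContDiffOn ℝ 1 c U)
    (he : ContDiffOn ℝ 1 e U)
    (hclosed : ∀ p ∈ U, fderiv ℝ a p (Pi.single 1 1) = fderiv ℝ b p (Pi.single 0 1))
    (sa : IsSemialgebraicFunOn ℚ U a) (sb : IsSemialgebraicFunOn ℚ U b)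
    (sc : IsSemialgebraicFunOn ℚ U c) (se : IsSemialgebraicFunOn ℚ U e)
    (sa₀ : IsSemialgebraicFunOn ℚ U fun p => fderiv ℝ a p (Pi.single 0 1))
    (sa₁ : IsSemialgebraicFunOn ℚ U fun p => fderiv ℝ a p (Pi.single 1 1))
    (sb₁ : IsSemialgebraicFunOn ℚ U fun p => fderiv ℝ b p (Pi.single 1 1))
    (sc₁ : IsSemialgebraicFunOn ℚ U fun p => fderiv ℝ c p (Pi.single 1 1))
    (se₀ : IsSemialgebraicFunOn ℚ U fun p => fderiv ℝ e p (Pi.single 0 1)) :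
    UnfoldedStokesData 1 where
  U := U
  a := ![a, b]
  g := ![e, c]
  isOpen := hU
  Icc_subset := hUI
  smul_mem := hstar
  contDiffOn_a i := by fin_cases i <;> assumption
  contDiffOn_g j := by fin_cases j <;> assumption
  closed i j p hp := by
    fin_cases i <;> fin_cases j
    · rfl
    · exact hclosed p hp
    · exact (hclosed p hp).symm
    · rfl
  isSemialgebraicFunOn_a i := by fin_cases i <;> assumption
  isSemialgebraicFunOn_g j := by fin_cases j <;> assumption
  isSemialgebraicFunOn_fderiv_a i j := by
    fin_cases i <;> fin_cases j
    · exact sa₀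
    · exact sa₁
    · exact sa₁.congr fun p hp => hclosed p hp
    · exact sb₁
  isSemialgebraicFunOn_fderiv_g j := by
    fin_cases j
    · exact se₀
    · exact sc₁

/-- Sums over `Fin (1 + 1)` (the index type of the square instance, in the form `1 + 1` in
which it arises from `UnfoldedStokesData 1`; numerals are written at type `Fin 2` as in the
crux). [folklore] -/
private theorem sum_two' {M : Type*} [AddCommMonoid M] (f : Fin (1 + 1) → M) :
    ∑ j, f j = f (0 : Fin 2) + f (1 : Fin 2) := Fin.sum_univ_two f

/-- `∀` over `Fin (1 + 1)`. [folklore] -/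
private theorem forall_two' {P : Fin (1 + 1) → Prop} :
    (∀ j, P j) ↔ P (0 : Fin 2) ∧ P (1 : Fin 2) := Fin.forall_fin_two

/-- `Fin.last 1 = 1`. [folklore] -/
private theorem last_one' : (Fin.last 1 : Fin (1 + 1)) = (1 : Fin 2) := rfl

/-- `Fin.last (1 + 1) = 2`. [folklore] -/
private theorem last_two' : (Fin.last (1 + 1) : Fin (1 + 2)) = (2 : Fin 3) := rfl

/-- `Fin.insertNth 0 c q = (c, q 0)` on `Fin 2`. [folklore] -/
private theorem insertNth_zero_two (c : ℝ) (q : Fin 1 → ℝ) :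
    Fin.insertNth (0 : Fin 2) c q = (![c, q 0] : Fin 2 → ℝ) := by
  ext i; fin_cases i <;> rfl

/-- `Fin.insertNth 1 c q = (q 0, c)` on `Fin 2`. [folklore] -/
private theorem insertNth_one_two (c : ℝ) (q : Fin 1 → ℝ) :
    Fin.insertNth (1 : Fin 2) c q = (![q 0, c] : Fin 2 → ℝ) := by
  ext i; fin_cases i <;> rfl

/-- `Fin.init` on `Fin 2`. [folklore] -/
private theorem init_two (y : Fin (1 + 1) → ℝ) : Fin.init y = (![y (0 : Fin 2)] : Fin 1 → ℝ) := by
  ext i; fin_cases i; rfl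

/-- `Fin.init` on `Fin 3`. [folklore] -/
private theorem init_three (z : Fin (1 + 2) → ℝ) :
    Fin.init z = (![z (0 : Fin 3), z (1 : Fin 3)] : Fin 2 → ℝ) := by
  ext i; fin_cases i <;> rfl

/-- Eta expansion of a vector of length `2`. [folklore] -/
private theorem eta_two (x : Fin 2 → ℝ) : (![x 0, x 1] : Fin 2 → ℝ) = x := by
  ext i; fin_cases i <;> rfl

/-- Scalar multiples of a vector of length `2`, the scalar action being that of
`Fin (1 + 1) → ℝ` as in `unfolding` (three shapes, so that no numeral is rewritten inside the
arguments of the coefficient functions). [folklore] -/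
private theorem smul_vec_two (u p q : ℝ) :
    @HSMul.hSMul ℝ (Fin (1 + 1) → ℝ) (Fin (1 + 1) → ℝ) instHSMul u ![p, q] =
      (![u * p, u * q] : Fin 2 → ℝ) := by
  ext i; fin_cases i <;> rfl

/-- `u • (0, q) = (0, u q)`. [folklore] -/
private theorem smul_vec_two₀ (u q : ℝ) :
    @HSMul.hSMul ℝ (Fin (1 + 1) → ℝ) (Fin (1 + 1) → ℝ) instHSMul u ![0, q] =
      (![0, u * q] : Fin 2 → ℝ) := by
  ext i; fin_cases i
  · exact mul_zero u
  · rfl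

/-- `u • (1, q) = (u, u q)`. [folklore] -/
private theorem smul_vec_two₁ (u q : ℝ) :
    @HSMul.hSMul ℝ (Fin (1 + 1) → ℝ) (Fin (1 + 1) → ℝ) instHSMul u ![1, q] =
      (![u, u * q] : Fin 2 → ℝ) := by
  ext i; fin_cases i
  · exact mul_one u
  · rfl

/-- `u • (p, 0) = (u p, 0)`. [folklore] -/
private theorem smul_vec_two₀' (u p : ℝ) :
    @HSMul.hSMul ℝ (Fin (1 + 1) → ℝ) (Fin (1 + 1) → ℝ) instHSMul u ![p, 0] =
      (![u * p, 0] : Fin 2 → ℝ) := by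
  ext i; fin_cases i
  · rfl
  · exact mul_zero u

/-- `u • (p, 1) = (u p, u)`. [folklore] -/
private theorem smul_vec_two₁' (u p : ℝ) :
    @HSMul.hSMul ℝ (Fin (1 + 1) → ℝ) (Fin (1 + 1) → ℝ) instHSMul u ![p, 1] =
      (![u * p, u] : Fin 2 → ℝ) := by
  ext i; fin_cases i
  · rfl
  · exact mul_one u

/-- **The square.** Under the hypotheses of crux `UnfoldedStokesSquare` of route
KontsevichZagierPeriods/UnfoldedStokes, verbatim — `U ⊇ [0,1]²` open and star-shaped about `0`;
`a b c e` `C¹` and `ℚ`-semialgebraic on `U` with the five first partials that occur; `ω = a ds +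
b dt` closed; representations `rB rR rT rL` (bottom/right/top/left edge `× (0,1)`, integrands
`Ω · η(edge tangent)` with `Ω(s,t,u) = s·a(us,ut) + t·b(us,ut)`, `η = c ds + e dt`),
`rW = [(0,1)², ae − bc]`, `rD = [(0,1)³, Ω·(∂ₛe − ∂ₜc)]` — the combination
`[rB] + [rR] − [rT] − [rL] − [rW] − [rD]` is an unfolded Stokes relator: it is the `stokesRelator`
of `UnfoldedStokesData.square` carried by `r₀ = (rL, rB)`, `r₁ = (rR, rT)`. Hence thesis part A
(`unfoldedStokesRel ⊆ relations`) implies the crux. [cite: KontsevichZagierPeriods2001, §1.2 rule 3] -/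
theorem square_mem_unfoldedStokesRel (hU : IsOpen U) (hUI : Icc (0 : Fin 2 → ℝ) 1 ⊆ U)
    (hstar : ∀ p ∈ U, ∀ u ∈ Icc (0 : ℝ) 1, u • p ∈ U)
    (ha : ContDiffOn ℝ 1 a U) (hb : ContDiffOn ℝ 1 b U) (hc : ContDiffOn ℝ 1 c U)
    (he : ContDiffOn ℝ 1 e U)
    (hclosed : ∀ p ∈ U, fderiv ℝ a p (Pi.single 1 1) = fderiv ℝ b p (Pi.single 0 1))
    (sa : IsSemialgebraicFunOn ℚ U a) (sb : IsSemialgebraicFunOn ℚ U b)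
    (sc : IsSemialgebraicFunOn ℚ U c) (se : IsSemialgebraicFunOn ℚ U e)
    (sa₀ : IsSemialgebraicFunOn ℚ U fun p => fderiv ℝ a p (Pi.single 0 1))
    (sa₁ : IsSemialgebraicFunOn ℚ U fun p => fderiv ℝ a p (Pi.single 1 1))
    (sb₁ : IsSemialgebraicFunOn ℚ U fun p => fderiv ℝ b p (Pi.single 1 1))
    (sc₁ : IsSemialgebraicFunOn ℚ U fun p => fderiv ℝ c p (Pi.single 1 1))
    (se₀ : IsSemialgebraicFunOn ℚ U fun p => fderiv ℝ e p (Pi.single 0 1))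
    (rB rR rT rL rW : IntegralRep 2) (rD : IntegralRep 3)
    (hBd : rB.domain = {x | ∀ i, x i ∈ Ioo (0 : ℝ) 1})
    (hB : EqOn rB.integrand (fun x => x 0 * a ![x 1 * x 0, 0] * c ![x 0, 0]) rB.domain)
    (hRd : rR.domain = {x | ∀ i, x i ∈ Ioo (0 : ℝ) 1})
    (hR : EqOn rR.integrand
      (fun x => (a ![x 1, x 1 * x 0] + x 0 * b ![x 1, x 1 * x 0]) * e ![1, x 0]) rR.domain)
    (hTd : rT.domain = {x | ∀ i, x i ∈ Ioo (0 : ℝ) 1})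
    (hT : EqOn rT.integrand
      (fun x => (x 0 * a ![x 1 * x 0, x 1] + b ![x 1 * x 0, x 1]) * c ![x 0, 1]) rT.domain)
    (hLd : rL.domain = {x | ∀ i, x i ∈ Ioo (0 : ℝ) 1})
    (hL : EqOn rL.integrand (fun x => x 0 * b ![0, x 1 * x 0] * e ![0, x 0]) rL.domain)
    (hWd : rW.domain = {x | ∀ i, x i ∈ Ioo (0 : ℝ) 1})
    (hW : EqOn rW.integrand
      (fun x => a ![x 0, x 1] * e ![x 0, x 1] - b ![x 0, x 1] * c ![x 0, x 1]) rW.domain)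
    (hDd : rD.domain = {x | ∀ i, x i ∈ Ioo (0 : ℝ) 1})
    (hD : EqOn rD.integrand
      (fun x => (x 0 * a ![x 2 * x 0, x 2 * x 1] + x 1 * b ![x 2 * x 0, x 2 * x 1]) *
        (fderiv ℝ e ![x 0, x 1] (Pi.single 0 1) - fderiv ℝ c ![x 0, x 1] (Pi.single 1 1)))
      rD.domain) :
    of rB + of rR - of rT - of rL - of rW - of rD ∈ unfoldedStokesRel := by
  let D : UnfoldedStokesData 1 :=
    UnfoldedStokesData.square hU hUI hstar ha hb hc he hclosed sa sb sc se sa₀ sa₁ sb₁ sc₁ se₀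
  have hDa : D.a = ![a, b] := rfl
  have hDg : D.g = ![e, c] := rfl
  have key : D.IsCarriedBy ![rL, rB] ![rR, rT] rW rD := by
    refine ⟨forall_two'.mpr ⟨hLd, hBd⟩, forall_two'.mpr ⟨?_, ?_⟩, forall_two'.mpr ⟨hRd, hTd⟩,
      forall_two'.mpr ⟨?_, ?_⟩, hWd, ?_, hDd, ?_⟩
    · intro y hy
      rw [Matrix.cons_val_zero, hL (show y ∈ rL.domain by rw [hLd]; exact hy)]
      simp only [UnfoldedStokesData.faceIntegrand, unfolding, hDa, hDg, init_two,
        insertNth_zero_two, last_one', sum_two', Matrix.cons_val_zero, Matrix.cons_val_one,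
        smul_vec_two₀]
      ring
    · intro y hy
      rw [Matrix.cons_val_one, Matrix.cons_val_fin_one,
        hB (show y ∈ rB.domain by rw [hBd]; exact hy)]
      simp only [UnfoldedStokesData.faceIntegrand, unfolding, hDa, hDg, init_two,
        insertNth_one_two, last_one', sum_two', Matrix.cons_val_zero, Matrix.cons_val_one,
        smul_vec_two₀']
      ring
    · intro y hy
      rw [Matrix.cons_val_zero, hR (show y ∈ rR.domain by rw [hRd]; exact hy)]
      simp only [UnfoldedStokesData.faceIntegrand, unfolding, hDa, hDg, init_two,
        insertNth_zero_two, last_one', sum_two', Matrix.cons_val_zero, Matrix.cons_val_one,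
        smul_vec_two₁]
      ring
    · intro y hy
      rw [Matrix.cons_val_one, Matrix.cons_val_fin_one,
        hT (show y ∈ rT.domain by rw [hTd]; exact hy)]
      simp only [UnfoldedStokesData.faceIntegrand, unfolding, hDa, hDg, init_two,
        insertNth_one_two, last_one', sum_two', Matrix.cons_val_zero, Matrix.cons_val_one,
        smul_vec_two₁']
      ring
    · intro x hx
      rw [hW (show x ∈ rW.domain by rw [hWd]; exact hx)]
      simp only [eta_two, UnfoldedStokesData.wedgeIntegrand, hDa, hDg, sum_two',
        Matrix.cons_val_zero, Matrix.cons_val_one, Fin.val_zero, Fin.val_one, pow_zero, pow_one]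
      ring
    · intro z hz
      rw [hD (show z ∈ rD.domain by rw [hDd]; exact hz)]
      simp only [UnfoldedStokesData.divIntegrand, unfolding, hDa, hDg, init_three, last_two',
        sum_two', Matrix.cons_val_zero, Matrix.cons_val_one, smul_vec_two, Fin.val_zero,
        Fin.val_one, pow_zero, pow_one]
      ring
  have hmem := D.stokesRelator_mem key
  rw [stokesRelator_one] at hmem
  simp only [Matrix.cons_val_zero, Matrix.cons_val_one, Matrix.cons_val_fin_one] at hmem
  exact hmem

end Square

end KZ

end Literature.NumberTheory.Transcendental
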